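import Summits.BirchSwinnertonDyer.BirchSwinnertonDyer.Theorems.UniversalToricDescentStrictPlaceNoPTorsion
import Summits.BirchSwinnertonDyer.BirchSwinnertonDyer.Theorems.CumulativeHeegnerLeopoldtCumulativeHeegnerInclusionAtThreeLineBaseChange
import Summits.BirchSwinnertonDyer.BirchSwinnertonDyer.Theorems.CumulativeHeegnerLeopoldtCumulativeHeegnerInclusionAtThreeStubLineDeterminantAtThree
import Summits.BirchSwinnertonDyer.Rank1Residual.X2.ResidualDevissageModules
import Literature.NumberTheory.EllipticCurves.Isogeny
import Literature.NumberTheory.EllipticCurves.SelmerCorankAssembly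
import HarnessLib

/-!
# Route `PrintCFram`, crux C2 `BottomClassIndexLawFiveLe` (stmt-BirchSwinnertonDyer-20372), line
# `eisenstein-resource-bdp-line`: the per-frame residual LINE over a number field `K` cut out by a
# rational `p`-isogeny `g : W → W₁`, with NO fixed vectors in the line or in the quotient under
# `G_{K_{∞,𝔭}} = ker κ ⊓ D_𝔭` as soon as `W(ℚ_p)[p] = 0` and `W₁(ℚ_p)[p] = 0` (`𝔭 ∋ p` of degree one)
# (cell `bsd-print-cfram`, seat `bsd-line-cfram-p1` LEAD g4; helper `--supports` 20372; 0 facts, 0 defs)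

HONEST FRAMING. Nothing about BSD is proved here. GENERIC in `W, W₁, p, K, κ, 𝔭`: for ANY isogeny
`g : W → W₁` over `ℚ` of degree `p` (`#ker g = p`), ANY number field `K`, ANY `ℤ_p`-extension `κ` and ANY
degree-one prime `𝔭 ∋ p` of `K`, the base change of `ker g` to `E_K[p]` (tree
`…LineBaseChange.exists_geomTorsion_baseChange_equiv`) is a `Γ_K`-stable subgroup `S ≤ E_K[p]`
(`X2.ResidualDevissageModules.StableSubgroup`) with `#S = #(E_K[p]/S) = p`, and:
* `S` embeds `Γ_K`-equivariantly in `E_K[p^∞]`, so `W(ℚ_p)[p] = 0` ⟹ no non-zero `ker κ ⊓ D_𝔭`-fixed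
  vector in `S` (X11b `AcSelmer.fixedPoints_decomp_inf_kerSubgroup_eq_bot_of_noPTorsion` via UTD's
  `noFixedPTorsion_kerSubgroup_inf_decomp_of_noPTorsionPadic`);
* `E_K[p]/S` embeds `Γ_K`-equivariantly in `(W₁)_K[p] ⊆ (W₁)_K[p^∞]` THROUGH `g`, so `W₁(ℚ_p)[p] = 0` ⟹ no
  non-zero `ker κ ⊓ D_𝔭`-fixed vector in `E_K[p]/S`.
This is exactly the local input `(W[p]/Φ)^{G_{K''_{∞,𝔭'}}} = 0` of the line data consumed by
`stub_torsion_cmRamified_of_line` (p622599) and `stub_invariantMatch_cmRamified_of_line_of_analyticInequality`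
(p622121), and the «`θ|_{G_v̄} ≠ 1`» hypothesis of CGLS 2022 Prop. 14 for BOTH characters of
`E_K[p]^{ss}`. The CM-ramified rows supply `g` and the two no-`p`-torsion facts
(`…RationalPIsogeny.exists_rational_pIsogeny_noPTorsionPadic_of_cmRamified`, k7r). THEOREMS ONLY; no
definition, no named fact, no `sorry`; imports no `Theses` module. BSD is not proved by any of this.
References: [GreenbergVatsal2000] §2 p. 28 (the line `Φ`); [Castella2018Erratum] Lemma 2.1;
[CastellaGrossiLeeSkinner2022] §1.2 Prop. 14 (hypothesis `θ|_{G_v̄} ≠ 1`); [SilvermanAEC2009] III.4, VIII.§1.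
-/

set_option autoImplicit false
-- `…BirchSwinnertonDyer.BirchSwinnertonDyer.Theorems…` is the problem's mandated namespace (D-0017).
set_option linter.dupNamespace false

noncomputable section

open scoped Classical

namespace Summit.BirchSwinnertonDyer.BirchSwinnertonDyer.Theorems.PrintCFram.IsogenyLineData

open NumberField IsDedekindDomain Field WeierstrassCurve
open Literature.NumberTheory.EllipticCurves Literature.NumberTheory.EllipticCurves.GreenbergSelmer
  Literature.NumberTheory.GaloisRepresentations
  Summit.BirchSwinnertonDyer.Rank1Residual.X2.ResidualDevissageModules
  Summit.BirchSwinnertonDyer.BirchSwinnertonDyer.Theorems.CumulativeHeegnerInclusionAtThreeLineBaseChange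
  Summit.BirchSwinnertonDyer.BirchSwinnertonDyer.Theorems.UniversalToricDescentStrictPlace

universe u

/-! ## §1 The kernel of a degree-`p` isogeny lies in `E[p]` -/

/-- If `#ker g = p` then `ker g ≤ E[p]` (Lagrange). [folklore] -/
theorem ker_le_geomTorsion {W W₁ : WeierstrassCurve ℚ} (g : Isogeny W W₁) {p : ℕ} (hg : g.degree = p) :
    g.toAddMonoidHom.ker ≤ W.geomTorsion (p : ℤ) := by
  intro P hP
  have h1 : p • (⟨P, hP⟩ : g.toAddMonoidHom.ker) = 0 := by
    have : Nat.card g.toAddMonoidHom.ker = p := hg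
    rw [← this]
    exact card_nsmul_eq_zero'
  exact AddSubgroup.torsionBy.nsmul_iff.mpr (congrArg Subtype.val h1)

/-! ## §2 The base-changed kernel line `S ≤ E_K[p]` and its two embeddings -/

section Line

variable (W W₁ : WeierstrassCurve ℚ) [W.IsElliptic] [W₁.IsElliptic] (p : ℕ) [hp : Fact p.Prime]
  (g : Isogeny W W₁) (K : Type) [Field K] [NumberField K]

omit [W₁.IsElliptic] in
/-- **The residual LINE of a rational `p`-isogeny over `K`, with its two equivariant embeddings.** For an
isogeny `g : W → W₁` over `ℚ` of degree `p` and a number field `K`: a `Γ_K`-stable subgroup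
`S ≤ E_K[p]` of order `p` with quotient of order `p`, an INJECTIVE `Γ_K`-equivariant `S ↪ E_K[p]` (its
inclusion) and an INJECTIVE `Γ_K`-equivariant `E_K[p]/S ↪ (E₁)_K[p]` induced by `g` (base-changed along
`…LineBaseChange.exists_geomTorsion_baseChange_equiv` for `W` and `W₁`). [cite: GreenbergVatsal2000, §2 p. 28 (the line Φ and Ψ = E[p]/Φ)]
[cite: SilvermanAEC2009, III.4 (isogenies) and VIII.§1] -/
theorem exists_stableSubgroup_of_isogeny (hg : g.degree = p) :
    ∃ (S : StableSubgroup (absoluteGaloisGroup K) ((W.baseChange K).geomTorsion (p : ℤ)))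
      (gbar : S.Quot →+ (W₁.baseChange K).geomTorsion (p : ℤ)),
      Nat.card S.Sub = p ∧ Nat.card S.Quot = p ∧ Function.Injective gbar ∧
      ∀ (σ : absoluteGaloisGroup K) (y : S.Quot), gbar (σ • y) = σ • gbar y := by
  haveI hEK : (W.baseChange K).IsElliptic := inferInstanceAs (W.map (algebraMap ℚ K)).IsElliptic
  obtain ⟨t, ht⟩ := exists_geomTorsion_baseChange_equiv W K ((p : ℕ) : ℤ)
  obtain ⟨t₁, ht₁⟩ := exists_geomTorsion_baseChange_equiv W₁ K ((p : ℕ) : ℤ)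
  have hsymm : ∀ (σ : absoluteGaloisGroup K) (Q : (W.baseChange K).geomTorsion (p : ℤ)),
      t.symm (σ • Q) = resGal (K := ℚ) K σ • t.symm Q := fun σ Q ↦ by
    apply t.injective
    rw [t.apply_symm_apply, ht, t.apply_symm_apply]
  -- the restriction `g_p : E[p] → E₁[p]` of `g` (over `ℚ̄`), `Γ_ℚ`-equivariant
  let gp : W.geomTorsion (p : ℤ) →+ W₁.geomTorsion (p : ℤ) :=
    (g.toAddMonoidHom.restrict (W.geomTorsion (p : ℤ))).codRestrict (W₁.geomTorsion (p : ℤ)) fun P ↦ by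
      have hP : (p : ℤ) • (P : W.geomPoints) = 0 :=
        (Submodule.mem_torsionBy_iff (p : ℤ) (P : W.geomPoints)).mp P.2
      change g.toAddMonoidHom (P : W.geomPoints) ∈ W₁.geomTorsion (p : ℤ)
      refine (Submodule.mem_torsionBy_iff (p : ℤ) _).mpr ?_
      rw [← map_zsmul, hP, map_zero]
  have hgp : ∀ P : W.geomTorsion (p : ℤ), ((gp P : W₁.geomTorsion (p : ℤ)) : W₁.geomPoints) =
      g (P : W.geomPoints) := fun _ ↦ rfl
  have hgp_smul : ∀ (σ : absoluteGaloisGroup ℚ) (P : W.geomTorsion (p : ℤ)),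
      gp (σ • P) = σ • gp P := fun σ P ↦ by
    apply Subtype.ext
    rw [hgp, AddSubgroup.torsionBy.coe_smul, AddSubgroup.torsionBy.coe_smul, hgp, g.map_smul]
  -- `ker g_p ≃ ker g`, so `#ker g_p = p`
  have hgp_ker : Nat.card gp.ker = p := by
    have hle := ker_le_geomTorsion g hg
    have key : Nat.card gp.ker = Nat.card g.toAddMonoidHom.ker := Nat.card_congr
      { toFun := fun x ↦ ⟨(x.1 : W.geomPoints), by
          have hx := x.2
          rw [AddMonoidHom.mem_ker] at hx ⊢
          have := congrArg (Subtype.val : W₁.geomTorsion (p : ℤ) → W₁.geomPoints) hx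
          rw [hgp] at this
          exact this⟩
        invFun := fun P ↦ ⟨⟨P.1, hle P.2⟩, by
          rw [AddMonoidHom.mem_ker]
          apply Subtype.ext
          rw [hgp]
          exact P.2⟩
        left_inv := fun x ↦ rfl
        right_inv := fun P ↦ rfl }
    rw [key]
    exact hg
  -- the base-changed restriction `g̃ = t₁ ∘ g_p ∘ t⁻¹ : E_K[p] → (E₁)_K[p]`
  let gt : (W.baseChange K).geomTorsion (p : ℤ) →+ (W₁.baseChange K).geomTorsion (p : ℤ) :=
    t₁.toAddMonoidHom.comp (gp.comp t.symm.toAddMonoidHom)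
  have hgt : ∀ Q, gt Q = t₁ (gp (t.symm Q)) := fun _ ↦ rfl
  have hgt_smul : ∀ (σ : absoluteGaloisGroup K) (Q : (W.baseChange K).geomTorsion (p : ℤ)),
      gt (σ • Q) = σ • gt Q := fun σ Q ↦ by
    rw [hgt, hgt, hsymm, hgp_smul, ht₁]
  -- the stable subgroup `S = ker g̃`
  let S : StableSubgroup (absoluteGaloisGroup K) ((W.baseChange K).geomTorsion (p : ℤ)) :=
    ⟨gt.ker, fun σ {Q} hQ ↦ by
      rw [AddMonoidHom.mem_ker] at hQ ⊢
      rw [hgt_smul, hQ, smul_zero]⟩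
  have hSker : S.toAddSubgroup = gt.ker := rfl
  -- `#S = p`
  have hSub : Nat.card S.Sub = p := by
    have key : Nat.card gt.ker = Nat.card gp.ker := Nat.card_congr
      { toFun := fun x ↦ ⟨t.symm x.1, by
          have hx := x.2
          rw [AddMonoidHom.mem_ker, hgt] at hx
          rw [AddMonoidHom.mem_ker]
          exact (map_eq_zero_iff t₁ t₁.injective).mp hx⟩
        invFun := fun P ↦ ⟨t P.1, by
          rw [AddMonoidHom.mem_ker, hgt, t.symm_apply_apply]
          have hP := P.2
          rw [AddMonoidHom.mem_ker] at hP
          rw [hP, map_zero]⟩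
        left_inv := fun x ↦ Subtype.ext (t.apply_symm_apply x.1)
        right_inv := fun P ↦ Subtype.ext (t.symm_apply_apply P.1) }
    change Nat.card gt.ker = p
    rw [key, hgp_ker]
  have hQuot : Nat.card S.Quot = p :=
    CumulativeHeegnerInclusionAtThreeStubLineDeterminantAtThree.natCard_quot_eq (W.baseChange K) p S hSub
  -- the induced injective map on the quotient
  let gbar : S.Quot →+ (W₁.baseChange K).geomTorsion (p : ℤ) := QuotientAddGroup.kerLift gt
  have hgbar : ∀ m, gbar (S.proj m) = gt m := fun m ↦ QuotientAddGroup.kerLift_mk gt m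
  refine ⟨S, gbar, hSub, hQuot, QuotientAddGroup.kerLift_injective gt, fun σ y ↦ ?_⟩
  obtain ⟨m, rfl⟩ := S.proj_surjective y
  rw [S.smul_proj, hgbar, hgbar, hgt_smul]

variable {W p K} in
/-- **No fixed vectors from no local `p`-torsion, through an equivariant embedding into `E[p]`.** If
`W(ℚ_p)[p] = 0` and `𝔭 ∋ p` is a degree-one prime of `K`, then for ANY `Γ_K`-module `A` with an
injective `Γ_K`-equivariant additive map `j : A → E_K[p]`, no non-zero element of `A` is fixed by
`ker κ ⊓ D_𝔭` (X11b: `E_K[p^∞]^{D_𝔭 ⊓ ker κ} = 0`, Castella 2018 erratum Lemma 2.1).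
[cite: Castella2018Erratum, Thm. 1.1 (iv) and Lemma 2.1 (pp. 1–2)] -/
theorem eq_zero_of_fixed_of_embedding
    (hW : ∀ R : (W.baseChange ℚ_[p]).toAffine.Point, p • R = 0 → R = 0)
    (κ : ZpExtension K p) {𝔭 : HeightOneSpectrum (𝓞 K)} (h𝔭 : ((p : ℕ) : 𝓞 K) ∈ 𝔭.asIdeal)
    (he : 𝔭.asIdeal.ramificationIdx (𝓞 ℚ) = 1) (hf : 𝔭.asIdeal.inertiaDeg (𝓞 ℚ) = 1)
    {A : Type} [AddCommGroup A] [DistribMulAction (absoluteGaloisGroup K) A]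
    (j : A →+ (W.baseChange K).geomTorsion (p : ℤ)) (hj : Function.Injective j)
    (hjσ : ∀ (σ : absoluteGaloisGroup K) (a : A), j (σ • a) = σ • j a)
    (a : A) (ha : ∀ σ ∈ κ.kerSubgroup ⊓ decomp 𝔭, σ • a = a) : a = 0 := by
  set m : (W.baseChange K).geomPrimaryTorsion p :=
    AddSubgroup.inclusion (geomTorsion_le_geomPrimaryTorsion (W.baseChange K) p) (j a) with hm
  have hfix : ∀ σ ∈ κ.kerSubgroup ⊓ decomp 𝔭, σ • m = m := fun σ hσ ↦ by
    apply Subtype.ext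
    rw [primaryComponent.coe_smul, hm, AddSubgroup.coe_inclusion, ← AddSubgroup.torsionBy.coe_smul,
      ← hjσ, ha σ hσ]
  have hpm : p • m = 0 := by
    apply Subtype.ext
    rw [AddSubgroupClass.coe_nsmul, hm, AddSubgroup.coe_inclusion, ZeroMemClass.coe_zero]
    have h := (j a).2
    exact AddSubgroup.torsionBy.nsmul_iff.mp h
  have h0 := noFixedPTorsion_kerSubgroup_inf_decomp_of_noPTorsionPadic W p hW κ h𝔭 he hf m hfix hpm
  have hja : j a = 0 := by
    apply Subtype.ext
    have := congrArg Subtype.val h0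
    rw [hm, AddSubgroup.coe_inclusion] at this
    exact this
  exact hj (by rw [hja, map_zero])

/-- **THE LINE DATA OF A RATIONAL `p`-ISOGENY, local part.** `g : W → W₁` an isogeny over `ℚ` of degree
`p`, `W(ℚ_p)[p] = 0` and `W₁(ℚ_p)[p] = 0`; `K` ANY number field, `κ` ANY `ℤ_p`-extension, `𝔭 ∋ p` of
degree one. Then `E_K[p]` contains a `Γ_K`-stable subgroup `S` with `#S = #(E_K[p]/S) = p` such that
`ker κ ⊓ D_𝔭` (`= G_{K_{∞,𝔭}}` for the chosen place) fixes NO non-zero vector of `S` and NO non-zero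
vector of `E_K[p]/S` — the local hypothesis of the crux line's residual line data, and (a fortiori,
taking `κ`'s kernel away) «`D_𝔭` acts non-trivially on both characters of `E_K[p]^{ss}`», CGLS 2022
Prop. 14's `θ|_{G_v̄} ≠ 1` for `θ ∈ {φ, ψ}`. [cite: CastellaGrossiLeeSkinner2022, §1.2 Prop. 14 (hypothesis θ|_{G_v̄} ≠ 1) and §1.4]
[cite: Castella2018Erratum, Lemma 2.1 (pp. 1–2)] [cite: GreenbergVatsal2000, §2 p. 28] -/
theorem exists_line_noFixed_of_isogeny (hg : g.degree = p)
    (hW : ∀ R : (W.baseChange ℚ_[p]).toAffine.Point, p • R = 0 → R = 0)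
    (hW₁ : ∀ R : (W₁.baseChange ℚ_[p]).toAffine.Point, p • R = 0 → R = 0)
    (κ : ZpExtension K p) {𝔭 : HeightOneSpectrum (𝓞 K)} (h𝔭 : ((p : ℕ) : 𝓞 K) ∈ 𝔭.asIdeal)
    (he : 𝔭.asIdeal.ramificationIdx (𝓞 ℚ) = 1) (hf : 𝔭.asIdeal.inertiaDeg (𝓞 ℚ) = 1) :
    ∃ S : StableSubgroup (absoluteGaloisGroup K) ((W.baseChange K).geomTorsion (p : ℤ)),
      Nat.card S.Sub = p ∧ Nat.card S.Quot = p ∧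
      (∀ x : S.Sub, (∀ σ ∈ κ.kerSubgroup ⊓ decomp 𝔭, σ • x = x) → x = 0) ∧
      (∀ y : S.Quot, (∀ σ ∈ κ.kerSubgroup ⊓ decomp 𝔭, σ • y = y) → y = 0) := by
  obtain ⟨S, gbar, hSub, hQuot, hinj, hgbarσ⟩ := exists_stableSubgroup_of_isogeny W W₁ p g K hg
  refine ⟨S, hSub, hQuot, fun x hx ↦ ?_, fun y hy ↦ ?_⟩
  · exact eq_zero_of_fixed_of_embedding hW κ h𝔭 he hf S.incl S.incl_injective
      (fun σ x ↦ S.incl_smul σ x) x hx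
  · exact eq_zero_of_fixed_of_embedding (W := W₁) hW₁ κ h𝔭 he hf gbar hinj hgbarσ y hy

/-- **Corollaries in the shapes consumed downstream.** Same hypotheses; the conclusion lists: `#S = p`,
`#(E_K[p]/S) = p`, the subtype-indexed fixed-vector statement for the quotient (verbatim the local clause of
`stub_torsion_cmRamified_of_line`), and the two «`D_𝔭` does not act trivially» clauses (on `S` and on
`E_K[p]/S`) that CGLS Prop. 14 asks. [cite: CastellaGrossiLeeSkinner2022, §1.2 Prop. 14 and §1.4]
[cite: Castella2018Erratum, Lemma 2.1 (pp. 1–2)] -/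
theorem exists_line_clauses_of_isogeny (hg : g.degree = p)
    (hW : ∀ R : (W.baseChange ℚ_[p]).toAffine.Point, p • R = 0 → R = 0)
    (hW₁ : ∀ R : (W₁.baseChange ℚ_[p]).toAffine.Point, p • R = 0 → R = 0)
    (κ : ZpExtension K p) {𝔭 : HeightOneSpectrum (𝓞 K)} (h𝔭 : ((p : ℕ) : 𝓞 K) ∈ 𝔭.asIdeal)
    (he : 𝔭.asIdeal.ramificationIdx (𝓞 ℚ) = 1) (hf : 𝔭.asIdeal.inertiaDeg (𝓞 ℚ) = 1) :
    ∃ S : StableSubgroup (absoluteGaloisGroup K) ((W.baseChange K).geomTorsion (p : ℤ)),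
      Nat.card S.Sub = p ∧ Nat.card S.Quot = p ∧
      (∀ y : S.Quot, (∀ σ : ↥(κ.kerSubgroup ⊓ decomp 𝔭), σ • y = y) → y = 0) ∧
      (¬ ∀ σ ∈ decomp 𝔭, ∀ x : S.Sub, σ • x = x) ∧
      (¬ ∀ σ ∈ decomp 𝔭, ∀ y : S.Quot, σ • y = y) := by
  obtain ⟨S, hSub, hQuot, hS, hQ⟩ := exists_line_noFixed_of_isogeny W W₁ p g K hg hW hW₁ κ h𝔭 he hf
  have hp1 : 1 < p := hp.out.one_lt
  haveI : Finite S.Sub := Nat.finite_of_card_ne_zero (by rw [hSub]; exact hp.out.ne_zero)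
  haveI : Finite S.Quot := Nat.finite_of_card_ne_zero (by rw [hQuot]; exact hp.out.ne_zero)
  haveI : Nontrivial S.Sub := Finite.one_lt_card_iff_nontrivial.mp (by rw [hSub]; exact hp1)
  haveI : Nontrivial S.Quot := Finite.one_lt_card_iff_nontrivial.mp (by rw [hQuot]; exact hp1)
  refine ⟨S, hSub, hQuot, fun y hy ↦ hQ y fun σ hσ ↦ hy ⟨σ, hσ⟩, fun h ↦ ?_, fun h ↦ ?_⟩
  · obtain ⟨x, hx⟩ := exists_ne (0 : S.Sub)
    exact hx (hS x fun σ hσ ↦ h σ (Subgroup.mem_inf.mp hσ).2 x)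
  · obtain ⟨y, hy⟩ := exists_ne (0 : S.Quot)
    exact hy (hQ y fun σ hσ ↦ h σ (Subgroup.mem_inf.mp hσ).2 y)

end Line

end Summit.BirchSwinnertonDyer.BirchSwinnertonDyer.Theorems.PrintCFram.IsogenyLineData

end
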